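/-
Copyright (c) 2026 the pub-hodgecm-mathlib formalisation cell (harness21).  Prover seat hodgecm-mathlib-K2Liu-p11 (g0), Track B «K2-LIT»,
#184♮ = hLiu418 = `stmt-HodgeConjecture-24832`; LEAD F0P6-plan (g12) DEAL 2026-09-04T06:56:46Z ∕ «= ×3» 07:19:04Z, SIGS-RoadI-v3 §Hol
row H1-E (K2E5-plan (g5)), file E-3 of H1-E (REPORT-H1E-CENSUS.K2Liu-p11-g0.md §4).  THEOREMS ONLY (no `def`, no `instance`, no notation,
no named-fact hypothesis, no `sorry`).
-/
import Summits.HodgeConjecture.HodgeConjecture.Theorems.K2LiuHermitianTubeAction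
import Mathlib.Analysis.SpecialFunctions.Exponential
import Mathlib.Analysis.Calculus.Deriv.Mul
import Mathlib.Analysis.Calculus.Deriv.Pi
import Mathlib.Analysis.Calculus.Deriv.Polynomial
import Mathlib.Analysis.Calculus.FDeriv.Analytic
import Mathlib.Analysis.Calculus.ContDiff.Operations
import Mathlib.Analysis.Matrix.Normed
import Mathlib.LinearAlgebra.Matrix.Charpoly.Coeff
import HarnessLib

/-!
# Crux `HLiu418`, Road I, organ H1-E (hermitian-tube Cauchy–Riemann dictionary), file E-3:
# descent of a `K∞`-typed group function to the tube, transport by the Siegel section, and the Jacobi derivative of the automorphy factor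

Cell `hodgecm-mathlib`, crux item hLiu418 = `stmt-HodgeConjecture-24832` (helper lane `--supports`, count-neutral).

* §1 DESCENT.  For `Φ : (σ → M_{2n}(ℂ)) → ℂ` with the scalar `K∞`-type (T)
  `Φ (g u) = (∏_s det(denom u_s (i·1))^{k_s})⁻¹ Φ g` (`u ∈ Stab(i·1)^σ`), the quantity `(∏_s det(denom g_s (i·1))^{k_s}) · Φ g` depends only
  on the point `g · (i·1) ∈ ℌ_n^σ` (`prod_zpow_mul_eq_of_moeb_eq`): the ★ H1-A cocycle `det_denom_mul_of_posDef` and `u := g'⁻¹ g ∈ Stab(i·1)`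
  (`inv_mul_mem_UJ`, `moeb_inv_mul_I`).  This is what makes the descended `f (g·i1) := J(g)^k Φ(g)` of the (E0) dictionary well defined.
* §2 TRANSPORT by the ★ H1-B section `g₀ = transl X · levi R` (`R` hermitian invertible): `moeb (g₀ M) (i·1) = R · moeb M (i·1) · R + X` and
  `denom (g₀ M) (i·1) = R⁻¹ · denom M (i·1)` for `M ∈ U(J)` (`moeb_section_mul`, `denom_section_mul`).
* §3 JACOBI.  `det` is smooth in coordinates (`contDiff_det`), `d/dt|₀ det(1 + tE) = tr E` (`hasDerivAt_det_one_add_smul`, from Mathlib's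
  `Matrix.det_one_add_smul`), hence along any coordinate curve through `1` with velocity `E` (`hasDerivAt_det_comp_of_eq_one`), and the
  derivative at `0` of `y ↦ det (denom (exp (Λ y)) (i·1))` is `y ↦ tr (i (Λy)₂₁ + (Λy)₂₂)` (`exists_hasFDerivAt_det_denom_exp`) — the term that
  the `K∞`-type cancels in the Cauchy–Riemann check of E-4.
Matrix calculus with the `L∞`-operator norm opened INSIDE proofs only; exported statements scalar ∕ `Pi`-valued.
References: [Shimura1997, §§5–6]; [Bump1997, §2.1]; ball-lane template ★ `UnitaryBallCauchyRiemann`.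
HONEST LABEL: HC_CM is proved only modulo the 7 printed citations (2 remaining named inputs: hLiu418 = stmt-HodgeConjecture-24832,
h413 = stmt-HodgeConjecture-24833) until rung 0 closes; count-neutral helper, closes no socket.
-/

set_option autoImplicit false
set_option linter.dupNamespace false

noncomputable section

open scoped Matrix Topology ComplexOrder
open Filter Set NormedSpace Complex Matrix
open Literature.NumberTheory.ModularForms.SiegelUpperHalfSpace (num denom moeb num_def denom_def moeb_def moeb_mul moeb_one
  denom_mul)
open Summit.HodgeConjecture.HodgeConjecture.Cruxes.HLiu418.K2LiuHermitianTubeCocycle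
open Summit.HodgeConjecture.HodgeConjecture.Cruxes.HLiu418.K2LiuHermitianTubeAction

namespace Summit.HodgeConjecture.HodgeConjecture.Cruxes.HLiu418.K2LiuHermitianTubeDescend

variable {l : Type*} [Fintype l] [DecidableEq l]

/-! ## §1 Descent: `J(g)^k Φ(g)` depends only on `g · i1` -/

/-- Elements of `U(J)` are invertible. [cite: Shimura1997, §5.1] -/
theorem isUnit_det_of_mem_UJ {g : Matrix (l ⊕ l) (l ⊕ l) ℂ} (hg : gᴴ * Matrix.J l ℂ * g = Matrix.J l ℂ) : IsUnit g.det := by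
  have h := congrArg Matrix.det hg
  rw [det_mul, det_mul] at h
  have hJ : (Matrix.J l ℂ).det ≠ 0 := (Matrix.isUnit_det_J l ℂ).ne_zero
  refine isUnit_iff_ne_zero.2 fun h0 => hJ ?_
  rw [h0, mul_zero] at h
  exact h.symm

/-- The inverse of an element of `U(J)` lies in `U(J)`. [cite: Shimura1997, §5.1] -/
theorem inv_mem_UJ {g : Matrix (l ⊕ l) (l ⊕ l) ℂ} (hg : gᴴ * Matrix.J l ℂ * g = Matrix.J l ℂ) :
    (g⁻¹)ᴴ * Matrix.J l ℂ * g⁻¹ = Matrix.J l ℂ := by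
  have hu := isUnit_det_of_mem_UJ hg
  have huH : IsUnit gᴴ.det := by rw [det_conjTranspose]; exact hu.star
  have h1 : (g⁻¹)ᴴ * Matrix.J l ℂ * g⁻¹ = (gᴴ)⁻¹ * (gᴴ * Matrix.J l ℂ * g) * g⁻¹ := by
    rw [hg, conjTranspose_nonsing_inv]
  rw [h1]
  calc (gᴴ)⁻¹ * (gᴴ * Matrix.J l ℂ * g) * g⁻¹ = ((gᴴ)⁻¹ * gᴴ) * Matrix.J l ℂ * (g * g⁻¹) := by
        simp only [Matrix.mul_assoc]
    _ = Matrix.J l ℂ := by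
        rw [nonsing_inv_mul _ huH, mul_nonsing_inv _ hu, Matrix.one_mul, Matrix.mul_one]

/-- `g'⁻¹ g ∈ U(J)` for `g, g' ∈ U(J)`. [cite: Shimura1997, §5.1] -/
theorem inv_mul_mem_UJ {g g' : Matrix (l ⊕ l) (l ⊕ l) ℂ} (hg : gᴴ * Matrix.J l ℂ * g = Matrix.J l ℂ)
    (hg' : g'ᴴ * Matrix.J l ℂ * g' = Matrix.J l ℂ) : (g'⁻¹ * g)ᴴ * Matrix.J l ℂ * (g'⁻¹ * g) = Matrix.J l ℂ :=
  mul_mem_UJ (inv_mem_UJ hg') hg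

/-- If `g · i1 = g' · i1` then `g'⁻¹ g` fixes `i1`. [cite: Shimura1997, §6.4] -/
theorem moeb_inv_mul_I {g g' : Matrix (l ⊕ l) (l ⊕ l) ℂ} (hg : gᴴ * Matrix.J l ℂ * g = Matrix.J l ℂ)
    (hg' : g'ᴴ * Matrix.J l ℂ * g' = Matrix.J l ℂ) (heq : moeb g (I • 1) = moeb g' (I • 1)) :
    moeb (g'⁻¹ * g) (I • (1 : Matrix l l ℂ)) = I • 1 := by
  have hd : IsUnit (denom g (I • (1 : Matrix l l ℂ))).det := isUnit_det_denom hg posDef_im_I_smul_one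
  have hd' : IsUnit (denom g' (I • (1 : Matrix l l ℂ))).det := isUnit_det_denom hg' posDef_im_I_smul_one
  rw [moeb_mul hd, heq, ← moeb_mul hd', nonsing_inv_mul _ (isUnit_det_of_mem_UJ hg'), moeb_one]

section Descent

variable {σ : Type*} [Fintype σ] {n : ℕ}

/-- **DESCENT.**  Under the scalar `K∞`-type (T), `(∏_s det(denom g_s (i·1))^{k_s}) · Φ g` depends only on the point `(g_s · i1)_s`.
[cite: Shimura1997, §5.2] -/
theorem prod_zpow_mul_eq_of_moeb_eq (k : σ → ℤ) (Φ : (σ → Matrix (Fin n ⊕ Fin n) (Fin n ⊕ Fin n) ℂ) → ℂ)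
    (hT : ∀ g u : σ → Matrix (Fin n ⊕ Fin n) (Fin n ⊕ Fin n) ℂ,
      (∀ s, (g s)ᴴ * Matrix.J (Fin n) ℂ * g s = Matrix.J (Fin n) ℂ) →
      (∀ s, (u s)ᴴ * Matrix.J (Fin n) ℂ * u s = Matrix.J (Fin n) ℂ) → (∀ s, moeb (u s) (I • 1) = I • 1) →
      Φ (g * u) = (∏ s, (denom (u s) (I • (1 : Matrix (Fin n) (Fin n) ℂ))).det ^ k s)⁻¹ * Φ g)
    {g g' : σ → Matrix (Fin n ⊕ Fin n) (Fin n ⊕ Fin n) ℂ} (hg : ∀ s, (g s)ᴴ * Matrix.J (Fin n) ℂ * g s = Matrix.J (Fin n) ℂ)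
    (hg' : ∀ s, (g' s)ᴴ * Matrix.J (Fin n) ℂ * g' s = Matrix.J (Fin n) ℂ) (heq : ∀ s, moeb (g s) (I • 1) = moeb (g' s) (I • 1)) :
    (∏ s, (denom (g s) (I • (1 : Matrix (Fin n) (Fin n) ℂ))).det ^ k s) * Φ g =
      (∏ s, (denom (g' s) (I • (1 : Matrix (Fin n) (Fin n) ℂ))).det ^ k s) * Φ g' := by
  -- `u := g'⁻¹ g ∈ Stab(i1)^σ`, `g = g' u`
  set u : σ → Matrix (Fin n ⊕ Fin n) (Fin n ⊕ Fin n) ℂ := fun s => (g' s)⁻¹ * g s with hu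
  have huU : ∀ s, (u s)ᴴ * Matrix.J (Fin n) ℂ * u s = Matrix.J (Fin n) ℂ := fun s => inv_mul_mem_UJ (hg s) (hg' s)
  have huI : ∀ s, moeb (u s) (I • (1 : Matrix (Fin n) (Fin n) ℂ)) = I • 1 := fun s => moeb_inv_mul_I (hg s) (hg' s) (heq s)
  have hgu : g = g' * u := by
    funext s
    rw [Pi.mul_apply, hu, ← Matrix.mul_assoc, mul_nonsing_inv _ (isUnit_det_of_mem_UJ (hg' s)), Matrix.one_mul]
  -- cocycle: `J(g_s) = J(g'_s) J(u_s)`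
  have hcoc : ∀ s, (denom (g s) (I • (1 : Matrix (Fin n) (Fin n) ℂ))).det =
      (denom (g' s) (I • (1 : Matrix (Fin n) (Fin n) ℂ))).det * (denom (u s) (I • (1 : Matrix (Fin n) (Fin n) ℂ))).det := by
    intro s
    rw [hgu, Pi.mul_apply, det_denom_mul_of_posDef (huU s) posDef_im_I_smul_one, huI s]
  have hne : (∏ s, (denom (u s) (I • (1 : Matrix (Fin n) (Fin n) ℂ))).det ^ k s) ≠ 0 :=
    Finset.prod_ne_zero_iff.2 fun s _ => zpow_ne_zero _ (det_denom_ne_zero (huU s) posDef_im_I_smul_one)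
  have hΦ : Φ g = (∏ s, (denom (u s) (I • (1 : Matrix (Fin n) (Fin n) ℂ))).det ^ k s)⁻¹ * Φ g' := by
    rw [hgu]; exact hT g' u hg' huU huI
  rw [hΦ]
  simp_rw [hcoc, mul_zpow, Finset.prod_mul_distrib]
  rw [mul_assoc, ← mul_assoc (∏ s, (denom (u s) (I • (1 : Matrix (Fin n) (Fin n) ℂ))).det ^ k s), mul_inv_cancel₀ hne,
    one_mul]

end Descent

/-! ## §2 Transport by the Siegel section `transl X · levi R` -/

/-- `denom (transl X · levi R · M) (i·1) = R⁻¹ · denom M (i·1)`. [cite: Shimura1997, §6.4] -/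
theorem denom_section_mul (X R : Matrix l l ℂ) (M : Matrix (l ⊕ l) (l ⊕ l) ℂ) :
    denom (fromBlocks 1 X 0 1 * fromBlocks R 0 0 R⁻¹ * M) (I • (1 : Matrix l l ℂ)) = R⁻¹ * denom M (I • 1) := by
  rw [denom_mul, transl_mul_levi_eq, toBlocks_fromBlocks₂₁, toBlocks_fromBlocks₂₂, Matrix.zero_mul, zero_add]

/-- `moeb (transl X · levi R · M) (i·1) = R · moeb M (i·1) · R + X` for `R` invertible and `M ∈ U(J)`. [cite: Shimura1997, §6.4] -/
theorem moeb_section_mul {X R : Matrix l l ℂ} (hRu : IsUnit R.det) {M : Matrix (l ⊕ l) (l ⊕ l) ℂ}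
    (hM : Mᴴ * Matrix.J l ℂ * M = Matrix.J l ℂ) :
    moeb (fromBlocks 1 X 0 1 * fromBlocks R 0 0 R⁻¹ * M) (I • (1 : Matrix l l ℂ)) = R * moeb M (I • 1) * R + X := by
  have hdM : IsUnit (denom M (I • (1 : Matrix l l ℂ))).det := isUnit_det_denom hM posDef_im_I_smul_one
  have hdL : IsUnit (denom (fromBlocks R 0 0 R⁻¹) (moeb M (I • (1 : Matrix l l ℂ)))).det := by
    rw [denom_levi, det_nonsing_inv]
    exact hRu.ringInverse
  rw [moeb_mul hdM, moeb_mul hdL, moeb_levi, moeb_transl, nonsing_inv_nonsing_inv R hRu]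

/-! ## §3 Jacobi: the derivative of the automorphy factor along the chart -/

/-- `det` is smooth in the coordinates `l → l → ℂ` (a polynomial in the entries). [folklore] -/
theorem contDiff_det {m : WithTop ℕ∞} : ContDiff ℝ m (fun M : l → l → ℂ => (Matrix.of M).det) := by
  have h : (fun M : l → l → ℂ => (Matrix.of M).det) =
      fun M => ∑ τ : Equiv.Perm l, (Equiv.Perm.sign τ : ℂ) * ∏ i, M (τ i) i := by
    funext M
    rw [Matrix.det_apply']
    rfl
  rw [h]
  refine ContDiff.sum fun τ _ => contDiff_const.mul ?_
  exact contDiff_prod fun i _ => contDiff_apply_apply ℝ ℂ (τ i) i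

/-- **Jacobi at the identity**: `d/dt|_{t=0} det(1 + tE) = tr E` (real parameter). [folklore] -/
theorem hasDerivAt_det_one_add_smul (E : Matrix l l ℂ) :
    HasDerivAt (fun t : ℝ => ((1 : Matrix l l ℂ) + (t : ℂ) • E).det) E.trace 0 := by
  set p : Polynomial ℂ := ((1 + (Polynomial.X : Polynomial ℂ) • E.map Polynomial.C).det).divX.divX with hp
  have hdet : ∀ t : ℝ, ((1 : Matrix l l ℂ) + (t : ℂ) • E).det = 1 + E.trace * (t : ℂ) + p.eval (t : ℂ) * (t : ℂ) ^ 2 := by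
    intro t; rw [Matrix.det_one_add_smul]
  have hc : HasDerivAt (fun r : ℂ => 1 + E.trace * r + p.eval r * r ^ 2) E.trace ((0 : ℝ) : ℂ) := by
    rw [Complex.ofReal_zero]
    have h1 : HasDerivAt (fun r : ℂ => E.trace * r) (E.trace * 1) 0 := (hasDerivAt_id' (0 : ℂ)).const_mul E.trace
    have h2 : HasDerivAt (fun r : ℂ => p.eval r * r ^ 2)
        (p.derivative.eval 0 * (0 : ℂ) ^ 2 + p.eval 0 * ((2 : ℕ) * (0 : ℂ) ^ (2 - 1))) 0 :=
      (p.hasDerivAt 0).mul (hasDerivAt_pow 2 (0 : ℂ))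
    have h3 := (h1.const_add (1 : ℂ)).add h2
    refine h3.congr_deriv ?_
    simp
  have hreal := hc.comp_ofReal
  exact hreal.congr_of_eventuallyEq (Eventually.of_forall fun t => hdet t)

/-- `det` has a Fréchet derivative at `1` (in coordinates) whose value on `E` is `tr E`. [folklore] -/
theorem exists_hasFDerivAt_det_one :
    ∃ L : (l → l → ℂ) →L[ℝ] ℂ, HasFDerivAt (fun M : l → l → ℂ => (Matrix.of M).det) L (fun i j => (1 : Matrix l l ℂ) i j) ∧
      ∀ E : l → l → ℂ, L E = (Matrix.of E).trace := by
  have hd : HasFDerivAt (fun M : l → l → ℂ => (Matrix.of M).det)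
      (fderiv ℝ (fun M : l → l → ℂ => (Matrix.of M).det) (fun i j => (1 : Matrix l l ℂ) i j))
      (fun i j => (1 : Matrix l l ℂ) i j) :=
    ((contDiff_det (m := 1)).differentiable one_ne_zero _).hasFDerivAt
  refine ⟨_, hd, fun E => ?_⟩
  -- along the line `t ↦ 1 + tE`
  have h1 : HasDerivAt (fun t : ℝ => (Matrix.of ((fun i j => (1 : Matrix l l ℂ) i j) + t • E)).det)
      (fderiv ℝ (fun M : l → l → ℂ => (Matrix.of M).det) (fun i j => (1 : Matrix l l ℂ) i j) E) 0 := by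
    have hline : HasDerivAt (fun t : ℝ => (fun i j => (1 : Matrix l l ℂ) i j) + t • E) E 0 := by
      simpa using ((hasDerivAt_id (0 : ℝ)).smul_const E).const_add (fun i j => (1 : Matrix l l ℂ) i j)
    have hd0 : HasFDerivAt (fun M : l → l → ℂ => (Matrix.of M).det)
        (fderiv ℝ (fun M : l → l → ℂ => (Matrix.of M).det) (fun i j => (1 : Matrix l l ℂ) i j))
        ((fun t : ℝ => (fun i j => (1 : Matrix l l ℂ) i j) + t • E) 0) := by
      have hz : (fun t : ℝ => (fun i j => (1 : Matrix l l ℂ) i j) + t • E) 0 = fun i j => (1 : Matrix l l ℂ) i j := by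
        simp only [zero_smul, add_zero]
      rw [hz]; exact hd
    exact hd0.comp_hasDerivAt (0 : ℝ) hline
  have h2 : HasDerivAt (fun t : ℝ => (Matrix.of ((fun i j => (1 : Matrix l l ℂ) i j) + t • E)).det) (Matrix.of E).trace 0 := by
    have h := hasDerivAt_det_one_add_smul (Matrix.of E)
    refine h.congr_of_eventuallyEq (Eventually.of_forall fun t => ?_)
    congr 1
  exact h1.unique h2

/-- **Jacobi along a curve**: if a coordinate curve `c` through `c 0 = 1` has velocity `E` at `0`, then `t ↦ det (c t)` has derivative `tr E`
at `0`. [folklore] -/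
theorem hasDerivAt_det_comp_of_eq_one {c : ℝ → (l → l → ℂ)} {E : l → l → ℂ} (hc : HasDerivAt c E 0)
    (hc0 : c 0 = fun i j => (1 : Matrix l l ℂ) i j) :
    HasDerivAt (fun t : ℝ => (Matrix.of (c t)).det) (Matrix.of E).trace 0 := by
  obtain ⟨L, hL, hLE⟩ := (exists_hasFDerivAt_det_one : ∃ L : (l → l → ℂ) →L[ℝ] ℂ, _)
  rw [← hc0] at hL
  have h := hL.comp_hasDerivAt (0 : ℝ) hc
  rwa [hLE] at h

section Chart

variable {E : Type*} [NormedAddCommGroup E] [NormedSpace ℝ E]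

set_option backward.isDefEq.respectTransparency false in
/-- The entries of `y ↦ denom (exp (Λ y)) (i·1)` are smooth, and along the line `t ↦ t•y` have derivative `(i (Λy)₂₁ + (Λy)₂₂)_{ij}` at `0`.
[folklore] -/
theorem denom_exp_entry_calculus {m : WithTop ℕ∞} (Λ : E →L[ℝ] Matrix (l ⊕ l) (l ⊕ l) ℂ) (i j : l) :
    ContDiff ℝ m (fun y : E => denom (exp (Λ y)) (I • (1 : Matrix l l ℂ)) i j) ∧
      ∀ y : E, HasDerivAt (fun t : ℝ => denom (exp (Λ (t • y))) (I • (1 : Matrix l l ℂ)) i j)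
        ((I • (Λ y).toBlocks₂₁ + (Λ y).toBlocks₂₂) i j) 0 := by
  open scoped Matrix.Norms.Operator in
  have key : ContDiff ℝ m (fun y : E => (Matrix.entryLinearMap ℝ ℂ i j) (denom (exp (Λ y)) (I • (1 : Matrix l l ℂ)))) ∧
      ∀ y : E, HasDerivAt (fun t : ℝ => (Matrix.entryLinearMap ℝ ℂ i j) (denom (exp (Λ (t • y))) (I • (1 : Matrix l l ℂ))))
        ((Matrix.entryLinearMap ℝ ℂ i j) (I • (Λ y).toBlocks₂₁ + (Λ y).toBlocks₂₂)) 0 := by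
    set B₂₁ : Matrix (l ⊕ l) (l ⊕ l) ℂ →L[ℝ] Matrix l l ℂ := LinearMap.toContinuousLinearMap
      { toFun := fun M => M.toBlocks₂₁, map_add' := fun _ _ => rfl, map_smul' := fun _ _ => rfl } with hB₂₁
    set B₂₂ : Matrix (l ⊕ l) (l ⊕ l) ℂ →L[ℝ] Matrix l l ℂ := LinearMap.toContinuousLinearMap
      { toFun := fun M => M.toBlocks₂₂, map_add' := fun _ _ => rfl, map_smul' := fun _ _ => rfl } with hB₂₂
    have hfun : ∀ M : Matrix (l ⊕ l) (l ⊕ l) ℂ, denom M (I • (1 : Matrix l l ℂ)) = I • B₂₁ M + B₂₂ M := by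
      intro M; rw [denom_def, Matrix.mul_smul, Matrix.mul_one]; rfl
    refine ⟨?_, fun y => ?_⟩
    · have hexp : ContDiff ℝ m (fun y : E => exp (Λ y)) := by
        have h : ContDiff ℝ m (fun M : Matrix (l ⊕ l) (l ⊕ l) ℂ => exp M) :=
          contDiff_iff_contDiffAt.2 fun M => (NormedSpace.exp_analytic (𝕂 := ℝ) M).contDiffAt
        exact h.comp Λ.contDiff
      have h := ((B₂₁.contDiff.comp hexp).const_smul I).add (B₂₂.contDiff.comp hexp)
      have hfun' : (fun y : E => denom (exp (Λ y)) (I • (1 : Matrix l l ℂ))) =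
          fun y => I • (B₂₁ ∘ fun y => exp (Λ y)) y + (B₂₂ ∘ fun y => exp (Λ y)) y := by
        funext y; rw [hfun]; rfl
      have h' : ContDiff ℝ m (fun y : E => denom (exp (Λ y)) (I • (1 : Matrix l l ℂ))) := by rw [hfun']; exact h
      exact (Matrix.entryLinearMap ℝ ℂ i j).toContinuousLinearMap.contDiff.comp h'
    · have he : HasDerivAt (fun t : ℝ => exp (t • Λ y)) (Λ y) 0 := by
        have h := hasDerivAt_exp_smul_const' (𝕂 := ℝ) (Λ y) 0
        rwa [zero_smul, NormedSpace.exp_zero, mul_one] at h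
      have h1 : HasDerivAt (fun t : ℝ => B₂₁ (exp (t • Λ y))) (B₂₁ (Λ y)) 0 := B₂₁.hasFDerivAt.comp_hasDerivAt 0 he
      have h2 : HasDerivAt (fun t : ℝ => B₂₂ (exp (t • Λ y))) (B₂₂ (Λ y)) 0 := B₂₂.hasFDerivAt.comp_hasDerivAt 0 he
      have h := (h1.const_smul I).add h2
      have h3 := (Matrix.entryLinearMap ℝ ℂ i j).toContinuousLinearMap.hasFDerivAt.comp_hasDerivAt 0 h
      refine h3.congr_of_eventuallyEq (Eventually.of_forall fun t => ?_)
      show (Matrix.entryLinearMap ℝ ℂ i j) (denom (exp (Λ (t • y))) (I • (1 : Matrix l l ℂ))) = _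
      rw [map_smul, hfun]
      rfl
  exact key

/-- **The derivative of the automorphy factor along the chart.**  For any real-linear `Λ : E → M_{2n}(ℂ)`, `y ↦ det (denom (exp (Λ y)) (i·1))`
has a Fréchet derivative at `0` with values `y ↦ tr (i (Λy)₂₁ + (Λy)₂₂)`. [cite: Shimura1997, §5.6] -/
theorem exists_hasFDerivAt_det_denom_exp (Λ : E →L[ℝ] Matrix (l ⊕ l) (l ⊕ l) ℂ) :
    ∃ L : E →L[ℝ] ℂ, HasFDerivAt (fun y : E => (denom (exp (Λ y)) (I • (1 : Matrix l l ℂ))).det) L 0 ∧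
      ∀ y : E, L y = (I • (Λ y).toBlocks₂₁ + (Λ y).toBlocks₂₂).trace := by
  -- the coordinate map `F y = entries of denom (exp (Λ y)) (i·1)`
  set F : E → (l → l → ℂ) := fun y i j => denom (exp (Λ y)) (I • (1 : Matrix l l ℂ)) i j with hF
  have hFcd : ContDiff ℝ 1 F := contDiff_pi.2 fun i => contDiff_pi.2 fun j => (denom_exp_entry_calculus Λ i j).1
  have hG : ContDiff ℝ 1 (fun y : E => (Matrix.of (F y)).det) := (contDiff_det (m := 1)).comp hFcd
  have hGf : (fun y : E => (denom (exp (Λ y)) (I • (1 : Matrix l l ℂ))).det) = fun y => (Matrix.of (F y)).det := by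
    funext y; rfl
  rw [hGf]
  have hd : HasFDerivAt (fun y : E => (Matrix.of (F y)).det) (fderiv ℝ (fun y : E => (Matrix.of (F y)).det) 0) 0 :=
    ((hG.differentiable one_ne_zero) 0).hasFDerivAt
  refine ⟨_, hd, fun y => ?_⟩
  -- along the line `t ↦ t • y`
  have h1 : HasDerivAt (fun t : ℝ => (Matrix.of (F (t • y))).det) (fderiv ℝ (fun y : E => (Matrix.of (F y)).det) 0 y) 0 := by
    have hd0 : HasFDerivAt (fun y : E => (Matrix.of (F y)).det) (fderiv ℝ (fun y : E => (Matrix.of (F y)).det) 0)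
        ((fun t : ℝ => t • y) 0) := by
      have hz : (fun t : ℝ => t • y) 0 = 0 := by simp only [zero_smul]
      rw [hz]; exact hd
    have h := hd0.comp_hasDerivAt (0 : ℝ) ((hasDerivAt_id (0 : ℝ)).smul_const y)
    rwa [one_smul] at h
  have h2 : HasDerivAt (fun t : ℝ => (Matrix.of (F (t • y))).det) (Matrix.of (fun i j =>
      (I • (Λ y).toBlocks₂₁ + (Λ y).toBlocks₂₂) i j)).trace 0 := by
    refine hasDerivAt_det_comp_of_eq_one (c := fun t => F (t • y)) ?_ ?_
    · exact hasDerivAt_pi.2 fun i => hasDerivAt_pi.2 fun j => (denom_exp_entry_calculus (m := 1) Λ i j).2 y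
    · funext i j
      simp only [hF, zero_smul, map_zero, NormedSpace.exp_zero]
      rw [denom_def, ← fromBlocks_one, toBlocks_fromBlocks₂₁, toBlocks_fromBlocks₂₂, Matrix.zero_mul, zero_add]
  have h12 := h1.unique h2
  rw [h12]
  rfl

end Chart

end Summit.HodgeConjecture.HodgeConjecture.Cruxes.HLiu418.K2LiuHermitianTubeDescend

end
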